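import Literature.AlgebraicGeometry.Resolution.KrullRamificationHenselSubfields
import Literature.AlgebraicGeometry.Resolution.HenselizationProofs
import Mathlib.Algebra.Polynomial.Identities
import Mathlib.Algebra.Group.Subgroup.Pointwise
import HarnessLib

/-!
# GaloisDescentLU — Galois coming-down of henselian generation (decomp-res node «DescentLadder», lens-1 g23), tree companion 1/3

Content VERBATIM from PART A of the decomp-res lens-1 g23 node `HOME/decomp-res-lens-1/g23/DescentLadder.lean`
(HOME = run/shared/lean/pub/decomp-res; NODE-g23.md), re-namespaced `…Theorems.GaloisDescentLU` (one namespace across the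
three companion files `GaloisDescentLU`, `GaloisDescentLU2`, `GaloisDescentLU3`, split for the 400-line cap), typed against
the LANDED `Theorems.HenselKeyChainLU` (p803393), `Theorems.KeyChainLU` and `Literature…KrullRamificationHenselSubfields`;
nothing inlined; a pure addition (no existing file touched).  Landing target:
`Summits/ResolutionOfSingularities/ResolutionOfSingularities/Theorems/GaloisDescentLU.lean`
(`--kind proof --supports stmt-ResolutionOfSingularities-0641`, HELPER file of the host route `Valuative`).

WINDOW g23 item (K-e) (CRITIC-LEDGER row 167): the COMING-DOWN LAW.  A place `(K, O)` over `k` carrying a GALOIS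
HENSEL-DESCENT DATUM — a finite Galois `K′ | K` whose group fixes a valuation ring `O′` above `O` (`G = G_Z`), a
`G`-stable upstairs frame `F′ ⊆ K′` with `F′ ∩ K = F₁` a finitely generated KEY-CHAIN sub-top of `K` (`K | F₁` finite
separable), and a henselian generator `K′ = F′(η′)` over `O′ ∩ F′` with residue in that of `F′` — is itself a HENSEL
TOP over `F₁` (`henselKeyChainTopBelow_of_galoisHenselDescent`, file 2), hence admits relative local uniformization
(`relLU_of_galoisHenselDescent`, via the landed g22 law `relLU_of_henselKeyChainTop`); the located residual is re-cut
accordingly (`nonKHToricArchLUKeyHensel_iff_descent`, `closes_descent`, file 3).  Hypothesis-free: no port, no `TheoremD`.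

THIS FILE (PART A, ambient valued Galois theory in the style of `KrullRamificationHenselSubfields`: a valuation ring `V`
of `Ω`, a subfield `M`, a finite Galois `N | M` inside `Ω`): (A1) `apply_eq_of_henselRoot` — an element of the
decomposition group fixing the coefficients and the residue of a Hensel root fixes the root (Taylor expansion);
(A2) `le_fixingSubgroup_of_descent` — coming down of fixing subgroups; (A3) `exists_lift_mem_decompositionGroupIn` —
`Gal(N|M) = Gal(N|K)·Gal(N|F′)` with lifts in the decomposition group (conjugacy of extensions,
[ZariskiSamuel1960, VI §7 Thm 12 Cor 3] = tree `exists_algEquiv_smul_valuationSubring_eq`); (A4)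
`exists_henselRoot_of_galoisDescent` — the descent theorem: `K` lies in the inertia field, so `K = M(η)` for a
henselian `η` over `V ∩ M` ([KnafKuhlmann2009 = arXiv:math/0702856, Lemma 3.7 (3)] = tree
`exists_henselRoot_adjoin_eq_of_le_inertiaField`).
-/

noncomputable section

open IntermediateField Polynomial Literature.AlgebraicGeometry.Resolution
open scoped Pointwise

namespace Summit.ResolutionOfSingularities.ResolutionOfSingularities.Theorems.GaloisDescentLU

/-! ## PART A — ambient Galois coming-down of henselian generation (valued Galois theory) -/

universe u

variable {Ω : Type u} [Field Ω] (V : ValuationSubring Ω) {M : Subfield Ω}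
  (N : IntermediateField M Ω)

/-- **(A1) Rigidity of Hensel roots under the decomposition group.**  Let `g ∈ G_Z`,
`η ∈ V ∩ N` a root of a polynomial `f` whose coefficients lie in `V ∩ N` and are fixed by `g`,
with `f′(η)` a unit of `V`; if `g` moves `η` inside its residue class (`v(g η − η) < 1`) then
`g η = η`.  (Taylor expansion over the ring `V ∩ N`:
`0 = f(gη) = f′(η)(gη − η) + c (gη − η)²`, so `gη ≠ η` forces `f′(η) = −c (gη − η) ∈ 𝔪_V`.)
[folklore] -/
theorem apply_eq_of_henselRoot {g : N ≃ₐ[M] N} (hg : g ∈ decompositionGroupIn V N)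
    {η : N} (hηV : (η : Ω) ∈ V) (f : Polynomial N) (hcoefV : ∀ i, ((f.coeff i : N) : Ω) ∈ V)
    (hcoefg : ∀ i, g (f.coeff i) = f.coeff i) (hfη : f.eval η = 0)
    (hder : V.valuation (((derivative f).eval η : N) : Ω) = 1)
    (hres : V.valuation (((g η : N) : Ω) - η) < 1) : g η = η := by
  classical
  set A : ValuationSubring N := V.comap (algebraMap N Ω) with hAdef
  have hmemA : ∀ x : N, x ∈ A ↔ (x : Ω) ∈ V := fun x => ValuationSubring.mem_comap
  have hlifts : f ∈ Polynomial.lifts (algebraMap A N) := by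
    rw [Polynomial.lifts_iff_coeff_lifts]
    intro i
    exact ⟨⟨f.coeff i, (hmemA _).mpr (hcoefV i)⟩, rfl⟩
  obtain ⟨f₀, hf₀⟩ := (Polynomial.mem_lifts _).mp hlifts
  by_contra hne
  have hgηV : ((g η : N) : Ω) ∈ V := ((mem_decompositionGroupIn_iff V N g).mp hg η).mp hηV
  let η₀ : A := ⟨η, (hmemA _).mpr hηV⟩
  let d : A := ⟨g η - η, A.sub_mem ((hmemA _).mpr hgηV) ((hmemA _).mpr hηV)⟩
  have hd0 : d ≠ 0 := fun h => hne (sub_eq_zero.mp (congrArg Subtype.val h))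
  -- evaluations through `algebraMap A N`
  have hev : ∀ a : A, algebraMap A N (f₀.eval a) = f.eval (algebraMap A N a) := fun a => by
    rw [← hf₀, Polynomial.eval_map, Polynomial.eval₂_hom]
  have hevd : algebraMap A N ((derivative f₀).eval η₀) = (derivative f).eval η := by
    change _ = (derivative f).eval (algebraMap A N η₀)
    rw [← hf₀, Polynomial.derivative_map, Polynomial.eval_map, Polynomial.eval₂_hom]
  -- `f (g η) = 0` since `g` fixes the coefficients of `f`
  have hmapg : f.map (g : N →+* N) = f := by
    refine Polynomial.ext fun i => ?_
    rw [Polynomial.coeff_map]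
    exact hcoefg i
  have hfgη : f.eval (g η) = 0 := by
    have h1 := Polynomial.eval₂_hom (g : N →+* N) η (p := f)
    rw [← Polynomial.eval_map, hmapg, hfη, map_zero] at h1
    exact h1
  -- Taylor expansion in the domain `A`
  obtain ⟨c, hc⟩ := f₀.binomExpansion η₀ d
  have hsum : algebraMap A N (η₀ + d) = g η := by
    rw [map_add]
    change (η : N) + (g η - η) = g η
    ring
  have h0 : f₀.eval η₀ = 0 := by
    have h := hev η₀
    rw [show algebraMap A N η₀ = η from rfl, hfη] at h
    exact (map_eq_zero_iff _ (IsFractionRing.injective A N)).mp h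
  have h1 : f₀.eval (η₀ + d) = 0 := by
    have h := hev (η₀ + d)
    rw [hsum, hfgη] at h
    exact (map_eq_zero_iff _ (IsFractionRing.injective A N)).mp h
  rw [h1, h0, zero_add] at hc
  have h2 : (derivative f₀).eval η₀ = -(c * d) := by
    have h3 : d * ((derivative f₀).eval η₀ + c * d) = 0 := by linear_combination -hc
    have h4 := (mul_eq_zero.mp h3).resolve_left hd0
    linear_combination h4
  -- read `h2` in `Ω` through `φ : A → N → Ω`
  set φ : A →+* Ω := (algebraMap N Ω).comp (algebraMap A N) with hφ
  have hφle : ∀ a : A, V.valuation (φ a) ≤ 1 := fun a =>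
    (V.valuation_le_one_iff _).mpr ((hmemA _).mp a.2)
  have hφd : V.valuation (φ d) < 1 := by
    change V.valuation (((g η - η : N) : Ω)) < 1
    push_cast
    exact hres
  have hval : V.valuation (φ ((derivative f₀).eval η₀)) < 1 := by
    rw [h2, map_neg, Valuation.map_neg, map_mul, Valuation.map_mul]
    calc V.valuation (φ c) * V.valuation (φ d)
        ≤ 1 * V.valuation (φ d) := mul_le_mul' (hφle c) le_rfl
      _ < 1 := by rw [one_mul]; exact hφd
  have hval' : V.valuation (φ ((derivative f₀).eval η₀)) = 1 := by
    change V.valuation (((algebraMap A N ((derivative f₀).eval η₀) : N) : Ω)) = 1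
    rw [hevd]
    exact hder
  exact absurd hval' (ne_of_lt hval)

/-- Membership in the fixed field of the cyclic group `⟨g⟩` is being fixed by `g`. [folklore] -/
theorem mem_fixedField_zpowers_iff {g : N ≃ₐ[M] N} {y : N} :
    y ∈ fixedField (Subgroup.zpowers g) ↔ g y = y := by
  constructor
  · intro h
    exact (mem_fixedField_iff _ _).mp h g (Subgroup.mem_zpowers g)
  · intro h
    rw [mem_fixedField_iff]
    intro φ hφ
    obtain ⟨n, rfl⟩ := Subgroup.mem_zpowers_iff.mp hφ
    have key : ∀ m : ℕ, (g ^ m) y = y := fun m => by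
      induction m with
      | zero => simp
      | succ m ih => rw [pow_succ, AlgEquiv.mul_apply, h, ih]
    rcases n with (m | m)
    · rw [Int.ofNat_eq_natCast, zpow_natCast]
      exact key m
    · rw [zpow_negSucc]
      calc (g ^ (m + 1))⁻¹ y = (g ^ (m + 1))⁻¹ ((g ^ (m + 1)) y) := by rw [key (m + 1)]
        _ = y := by rw [← AlgEquiv.mul_apply, inv_mul_cancel, AlgEquiv.one_apply]

/-- **(A2) Coming down of fixing subgroups.**  If every `g ∈ D` fixing `F′` fixes `K′ ⊇ K`,
and every `τ ∈ D` agrees on `F′` with some `ρ ∈ D` fixing `K`, then `D` fixes `K`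
(`ψ := ρ⁻¹ τ ∈ D` fixes `F′`, hence `K′ ⊇ K`, so `τ = ρ` on `K`). [folklore] -/
theorem le_fixingSubgroup_of_descent (D : Subgroup (N ≃ₐ[M] N))
    {Kf K'f F'f : IntermediateField M N} (hKK' : Kf ≤ K'f)
    (hup : ∀ g ∈ D, g ∈ F'f.fixingSubgroup → g ∈ K'f.fixingSubgroup)
    (hsurj : ∀ τ ∈ D, ∃ ρ ∈ D, ρ ∈ Kf.fixingSubgroup ∧ ∀ x ∈ F'f, ρ x = τ x) :
    D ≤ Kf.fixingSubgroup := by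
  intro τ hτ
  obtain ⟨ρ, hρD, hρK, hρF⟩ := hsurj τ hτ
  have hψD : ρ⁻¹ * τ ∈ D := D.mul_mem (D.inv_mem hρD) hτ
  have hψF : ρ⁻¹ * τ ∈ F'f.fixingSubgroup := by
    rw [IntermediateField.mem_fixingSubgroup_iff]
    intro x hx
    rw [AlgEquiv.mul_apply, ← hρF x hx, ← AlgEquiv.mul_apply, inv_mul_cancel, AlgEquiv.one_apply]
  have hψK := hup _ hψD hψF
  rw [IntermediateField.mem_fixingSubgroup_iff] at hψK hρK ⊢
  intro x hx
  have h1 := hψK x (hKK' hx)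
  rw [AlgEquiv.mul_apply] at h1
  have h2 : τ x = ρ x := by
    have h3 := congrArg ρ h1
    rwa [← AlgEquiv.mul_apply, mul_inv_cancel, AlgEquiv.one_apply] at h3
  rw [h2, hρK x hx]

/-- **(A3) Lifting lemma.**  In a finite Galois extension `N | M` with `H = Gal(N | K)`,
`S = Gal(N | F′)`, `F′ ≤ K′`, `K ≤ K′`: if `H` stabilises `F′` and `V ∩ K′`, and `F′ ∩ K = M`,
then `G = H·S` with `S` normal, and every `τ ∈ G` agrees on `F′` with some `ρ ∈ H ∩ G_Z(V ∩ N)`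
(correct `h ∈ H` by an element of `Gal(N | K′)` using conjugacy of the extensions of `V ∩ K′`
to `N`). [cite: ZariskiSamuel1960, Ch. VI §7 Thm. 12 Cor. 3] -/
theorem exists_lift_mem_decompositionGroupIn [FiniteDimensional M N] [IsGalois M N]
    {Kf K'f F'f : IntermediateField M N} (hKK' : Kf ≤ K'f) (hF'K' : F'f ≤ K'f)
    (hdec : ∀ h ∈ Kf.fixingSubgroup, ∀ x ∈ K'f, ((x : N) : Ω) ∈ V ↔ ((h x : N) : Ω) ∈ V)
    (hstab : ∀ h ∈ Kf.fixingSubgroup, ∀ x ∈ F'f, h x ∈ F'f)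
    (hinv : ∀ x ∈ F'f, x ∈ Kf → x ∈ (⊥ : IntermediateField M N)) (τ : N ≃ₐ[M] N) :
    ∃ ρ ∈ decompositionGroupIn V N, ρ ∈ Kf.fixingSubgroup ∧ ∀ x ∈ F'f, ρ x = τ x := by
  classical
  set H : Subgroup (N ≃ₐ[M] N) := Kf.fixingSubgroup with hHdef
  set S : Subgroup (N ≃ₐ[M] N) := F'f.fixingSubgroup with hSdef
  -- Step 1: `H ⊔ S = ⊤` (its fixed field is `F′ ∩ K = M`)
  have hsup : H ⊔ S = ⊤ := by
    have h1 : fixedField (H ⊔ S) = ⊥ := by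
      rw [eq_bot_iff]
      intro x hx
      rw [IntermediateField.mem_fixedField_iff] at hx
      have hxF : x ∈ F'f := by
        have : x ∈ fixedField S :=
          (mem_fixedField_iff S x).mpr fun f hf => hx f (Subgroup.mem_sup_right hf)
        rwa [hSdef, IsGalois.fixedField_fixingSubgroup] at this
      have hxK : x ∈ Kf := by
        have : x ∈ fixedField H :=
          (mem_fixedField_iff H x).mpr fun f hf => hx f (Subgroup.mem_sup_left hf)
        rwa [hHdef, IsGalois.fixedField_fixingSubgroup] at this
      exact hinv x hxF hxK
    have h2 := IntermediateField.fixingSubgroup_fixedField (H ⊔ S)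
    rw [h1, IntermediateField.fixingSubgroup_bot] at h2
    exact h2.symm
  -- Step 2: `S` is normal (normalised by `H` since `H` stabilises `F′`, and by itself)
  have hSnormal : S.Normal := by
    rw [← Subgroup.normalizer_eq_top_iff, eq_top_iff, ← hsup]
    refine sup_le ?_ Subgroup.le_normalizer
    intro h hh
    rw [Subgroup.mem_normalizer_iff]
    intro s
    constructor
    · intro hs
      rw [hSdef, IntermediateField.mem_fixingSubgroup_iff] at hs ⊢
      intro x hx
      rw [AlgEquiv.mul_apply, AlgEquiv.mul_apply]
      have hx' : h⁻¹ x ∈ F'f := hstab _ (H.inv_mem hh) x hx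
      rw [hs _ hx', ← AlgEquiv.mul_apply, mul_inv_cancel, AlgEquiv.one_apply]
    · intro hs
      rw [hSdef, IntermediateField.mem_fixingSubgroup_iff] at hs ⊢
      intro x hx
      have hx' : h x ∈ F'f := hstab _ hh x hx
      have h3 := hs _ hx'
      rw [AlgEquiv.mul_apply, AlgEquiv.mul_apply, ← AlgEquiv.mul_apply h⁻¹ h x, inv_mul_cancel,
        AlgEquiv.one_apply] at h3
      exact h.injective h3
  -- Step 3: `τ = h * s`
  haveI := hSnormal
  have hτ' : τ ∈ ((H ⊔ S : Subgroup (N ≃ₐ[M] N)) : Set (N ≃ₐ[M] N)) := by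
    rw [hsup]; exact Subgroup.mem_top τ
  rw [Subgroup.mul_normal] at hτ'
  obtain ⟨h, hh, s, hs, hτhs⟩ := Set.mem_mul.mp hτ'
  have hh : h ∈ H := hh
  have hs : s ∈ S := hs
  -- Step 4: correct `h` by an element of `Gal(N | K′)` into the decomposition group
  set W : ValuationSubring N := V.comap (algebraMap N Ω) with hW
  haveI : IsGalois K'f N := IsGalois.tower_top_of_isGalois M K'f N
  have hVW : W.comap (algebraMap K'f N) = (h⁻¹ • W).comap (algebraMap K'f N) := by
    ext x
    change (algebraMap K'f N x) ∈ W ↔ (algebraMap K'f N x) ∈ h⁻¹ • W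
    rw [ValuationSubring.mem_inv_pointwise_smul_iff, AlgEquiv.smul_def, hW,
      ValuationSubring.mem_comap, ValuationSubring.mem_comap]
    exact hdec h hh x x.2
  obtain ⟨σ, hσ⟩ := exists_algEquiv_smul_valuationSubring_eq (K := K'f) (L := N) W (h⁻¹ • W) hVW
  set h' : N ≃ₐ[M] N := σ.restrictScalars M with hh'
  have hh'K' : h' ∈ K'f.fixingSubgroup := by
    rw [IntermediateField.mem_fixingSubgroup_iff]
    intro x hx
    exact σ.commutes ⟨x, hx⟩
  have hh'H : h' ∈ H := IntermediateField.fixingSubgroup_le hKK' hh'K'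
  have hsmul : h' • W = h⁻¹ • W := by
    rw [← hσ]
    ext x
    simp only [ValuationSubring.mem_smul_pointwise_iff_exists, AlgEquiv.smul_def]
    rfl
  refine ⟨h * h', ?_, H.mul_mem hh hh'H, ?_⟩
  · rw [mem_decompositionGroupIn_iff_smul_eq, ← hW, mul_smul, hsmul, ← mul_smul, mul_inv_cancel,
      one_smul]
  · intro x hx
    rw [← hτhs, AlgEquiv.mul_apply, AlgEquiv.mul_apply]
    rw [IntermediateField.mem_fixingSubgroup_iff] at hh'K'
    rw [hSdef, IntermediateField.mem_fixingSubgroup_iff] at hs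
    rw [hh'K' x (hF'K' hx), hs x hx]

/-- **(A4) Galois coming-down of henselian generation along a stable frame.**  Let `N | M` be
finite Galois inside `Ω`, `V` a valuation ring of `Ω`, and `M ≤ K ≤ K′ ≤ N`, `F′ ≤ K′` intermediate
fields with: `H = Gal(N | K)` stabilises `V ∩ K′` and `F′`; `F′ ∩ K = M`; and `K′ ≤ F′(η′)` for a
HENSELIAN ELEMENT `η′` over `V ∩ F′` (a root of `f ∈ (V ∩ F′)[X]` with `f′(η′) ∈ V^×`) whose
residue lies in that of `F′`.  Then `K` lies in the inertia field of `V ∩ N` over `M`, hence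
`K = M(η)` for a henselian element `η` over `V ∩ M`:  the Hensel datum COMES DOWN from the frame
`F′` to the frame `M = F′ ∩ K`.  (A1: `G_Z ∩ Gal(N | F′)` fixes `η′`, so fixes `K′ ⊇ K`;
A3 + A2: `G_Z ≤ Gal(N | K)`; then `G_T ≤ G_Z` and [KK09, 3.7 (3)].)
[cite: KnafKuhlmann2009, Lemma 3.7 (3)] [cite: ZariskiSamuel1960, Ch. VI §7 Thm. 12 Cor. 3] -/
theorem exists_henselRoot_of_galoisDescent [FiniteDimensional M N] [IsGalois M N]
    {Kf K'f F'f : IntermediateField M N} (hKK' : Kf ≤ K'f) (hF'K' : F'f ≤ K'f)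
    (hdec : ∀ h ∈ Kf.fixingSubgroup, ∀ x ∈ K'f, ((x : N) : Ω) ∈ V ↔ ((h x : N) : Ω) ∈ V)
    (hstab : ∀ h ∈ Kf.fixingSubgroup, ∀ x ∈ F'f, h x ∈ F'f)
    (hinv : ∀ x ∈ F'f, x ∈ Kf → x ∈ (⊥ : IntermediateField M N))
    {η' : N} (hη'V : ((η' : N) : Ω) ∈ V) (hres : ∃ c ∈ F'f, V.valuation (((η' : N) : Ω) - c) < 1)
    (hgen : ∀ E : IntermediateField M N, F'f ≤ E → η' ∈ E → K'f ≤ E)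
    (f : Polynomial N) (hcoef : ∀ i, ((f.coeff i : N) : Ω) ∈ V ∧ f.coeff i ∈ F'f)
    (hfη : f.eval η' = 0) (hder : V.valuation (((derivative f).eval η' : N) : Ω) = 1) :
    ∃ η : N, (η : Ω) ∈ V ∧
      (∃ F : Polynomial Ω, F.Monic ∧ (∀ i, F.coeff i ∈ V ∧ F.coeff i ∈ M) ∧
        F.eval (η : Ω) = 0 ∧ V.valuation ((derivative F).eval (η : Ω)) = 1) ∧
      Kf = IntermediateField.adjoin M ({η} : Set N) := by
  classical
  have hup : ∀ g ∈ decompositionGroupIn V N, g ∈ F'f.fixingSubgroup → g ∈ K'f.fixingSubgroup := by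
    intro g hgD hgF
    rw [IntermediateField.mem_fixingSubgroup_iff] at hgF ⊢
    have hgη : g η' = η' := by
      refine apply_eq_of_henselRoot V N hgD hη'V f (fun i => (hcoef i).1)
        (fun i => hgF _ (hcoef i).2) hfη hder ?_
      obtain ⟨c, hcF, hc⟩ := hres
      have h1 : V.valuation (((g (η' - c) : N) : Ω)) < 1 :=
        (valuation_lt_one_iff_of_mem_decompositionGroupIn V N hgD (η' - c)).mp
          (by push_cast; exact hc)
      have h2 : ((g η' : N) : Ω) - η' = ((g (η' - c) : N) : Ω) - (((η' : N) : Ω) - c) := by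
        rw [map_sub, hgF c hcF]
        push_cast
        ring
      rw [h2]
      calc V.valuation (((g (η' - c) : N) : Ω) - (((η' : N) : Ω) - c))
          ≤ max (V.valuation (((g (η' - c) : N) : Ω))) (V.valuation (((η' : N) : Ω) - c)) :=
            Valuation.map_sub _ _ _
        _ < 1 := max_lt h1 hc
    have hle : K'f ≤ fixedField (Subgroup.zpowers g) :=
      hgen _ (fun y hy => (mem_fixedField_zpowers_iff N).mpr (hgF y hy))
        ((mem_fixedField_zpowers_iff N).mpr hgη)
    intro x hx
    exact (mem_fixedField_zpowers_iff N).mp (hle hx)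
  have hsurj : ∀ τ ∈ decompositionGroupIn V N, ∃ ρ ∈ decompositionGroupIn V N,
      ρ ∈ Kf.fixingSubgroup ∧ ∀ x ∈ F'f, ρ x = τ x :=
    fun τ _ => exists_lift_mem_decompositionGroupIn V N hKK' hF'K' hdec hstab hinv τ
  have hDK : decompositionGroupIn V N ≤ Kf.fixingSubgroup :=
    le_fixingSubgroup_of_descent N _ hKK' hup hsurj
  have hT : Kf ≤ fixedField (inertiaGroupIn V N) := by
    rw [IntermediateField.le_iff_le]
    exact le_trans (inertiaGroupIn_le_decompositionGroupIn V N) hDK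
  exact exists_henselRoot_adjoin_eq_of_le_inertiaField V N Kf hT


end Summit.ResolutionOfSingularities.ResolutionOfSingularities.Theorems.GaloisDescentLU

end
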